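/-
Copyright: b2b-lace packet (CARVER gen 41, census v5 "slack ledger", node TPAIR-TAB).
Companions of the Cauchy–Schwarz PAIRING for the SRW-table cell `T_{n,l}(x)` of [NoBLE17-I] (3.37)
(`SrwIntegralTPairing.lean`): the pairing with a GENERAL split of the `Ĉ`-power, and upper bounds for its
partner integral `M₂_{c,m}` through the paper's own `I`, `U` ((3.35), (3.38)) that need integrability of
`Ĉ^c` only (not of `Ĉ^{c+2}`).  Elementary; hypothesis-free; no `sorry`; no statement at any specific dimension.
-/
import Literature.Probability.FitznerVanDerHofstad2017.SrwIntegralTPairing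
import HarnessLib

/-!
# `M₂_{c,m}` through `I` and `U`, and the pairing with a general `Ĉ`-split

CITATION HEADER (PLACEMENT v2). Part of the certified REPRODUCTION of the numerical inputs of
R. Fitzner, R. van der Hofstad, *Generalized approach to the non-backtracking lace expansion*,
Probab. Theory Related Fields 169 (2017) 1041–1119 [NoBLE17-I] (arXiv:1506.07969), §3.3.3 and §5.2
((3.26), (3.35)–(3.38) p. 1070–1071; (5.7)–(5.13) p. 1091–1093), as consumed by *Mean-field behavior for
nearest-neighbor percolation in `d > 10`*, Electron. J. Probab. 22 (2017) no. 43 [FvdH17].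
Origin: build `lace`, unit `b2b-lace-carver-g41` (census v5: the slack of the printed SRW-atom devices).
Nothing here is a statement about percolation and nothing is evaluated at a specific `d`.

## What is proved, and why

`SrwIntegralTPairing.lean` bounds `T_{n,l}(x) = ∫ |D̂|^l Ĉⁿ |D̂^{(x)}| |M̂|` ((3.37); `M̂ = D̂ − 2 D̂^{sin} Ĉ`,
(3.26)) by ONE Cauchy–Schwarz step, `T_{α+β,m+j}(x) ≤ [M₂_{2α,m}]^{1/2} [W_{2β,j}(x)]^{1/2}` with
`M₂_{c,m} = ∫ D̂^{2m} M̂² Ĉ^c`, and evaluates `M₂_{c,m}` exactly through `I`, `V` when `d ≥ 2(c+2)+1`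
(`srwM2_eq`).  Two elementary complements are recorded here, both with the proof pattern of (5.9)
([HS92b] Lemma B.3, (B.25)–(B.27)):

* **general split** (`srwT_le_sqrt_srwM2_mul_srwW'`): for `c₁ + c₂ = 2n`, `d ≥ 2c₁+1`, `d ≥ 2c₂+1`,
  `T_{n,m+j}(x) ≤ [M₂_{c₁,m}]^{1/2} [W_{c₂,j}(x)]^{1/2}` — the split `(|D̂|^m |M̂| Ĉ^{c₁/2})·(|D̂|^j |D̂^{(x)}| Ĉ^{c₂/2})`
  with half-integer powers (`Ĉ ≥ 0`), so that odd `c₁`, `c₂` are admissible; and the table-ready corollary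
  `srwT_le_of_srwM2_le_of_srwW_le` (`M₂ ≤ A`, `W ≤ B`, `A·B ≤ t²`, `t ≥ 0` ⟹ `T ≤ t`);
* **`M₂` through `I`, `U` only** (`srwM2_le_I_U`): for `d ≥ 2c + 1`,
  `M₂_{c,m} ≤ I_{c,2m+2}(0) + 4 U_{c,2m}(0) − 4 (1 − 2/d) U_{c+1,2m}(0)`,
  from the pointwise identity (where `Ĉ(1 − D̂) = 1`, i.e. almost everywhere)
  `M̂² Ĉ^c = D̂² Ĉ^c + 4 D̂^{sin} Ĉ^c − 4 D̂^{sin} Ĉ^{c+1} (1 − D̂^{sin} Ĉ)` and `D̂^{sin} Ĉ ≤ 2/d` ((5.10): the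
  tree's `two_mul_Dsin_mul_Chat_le`).  The last integral `U_{c+1,2m}(0)` converges already for `d ≥ 2c+1`
  because `D̂^{sin} Ĉ` is bounded (`integrable_srwU_integrand_succ`), and a table consumer that has no
  enclosure of `U_{c+1}` bounds the subtracted term from BELOW through `U_{c−1}`, `U_c` by Cauchy–Schwarz in
  the `Ĉ`-power, `U_{n+1,l}(x)² ≤ U_{n,l}(x) U_{n+2,l}(x)` (`srwU_succ_sq_le`).
For `d ≥ 2(c+2)+1` the bound `srwM2_le_I_U` is implied by `srwM2_eq` + `(D̂^{sin})² Ĉ ≤ (2/d) D̂^{sin}` and the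
recursion (5.1); its point is the weaker integrability hypothesis.  None of this is the source's route (the
source needs no pairing at `d ≥ 11`); it is recorded as elementary kernel lemmas, not as cited facts, and no
numerical value appears.

## References
* [NoBLE17-I] R. Fitzner, R. van der Hofstad, PTRF 169 (2017) 1041–1119; arXiv:1506.07969 — (3.26), (3.35)–(3.38)
  p. 1070–1071; §5.2 (5.7)–(5.13) p. 1091–1093.
* [HS92b] T. Hara, G. Slade, *The lace expansion for self-avoiding walk in five or more dimensions*,
  Rev. Math. Phys. 4 (1992) 235–327 — Lemma B.3, (B.25)–(B.27) (the Schwarz-inequality device).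
* [HvdH17] M. Heydenreich, R. van der Hofstad, *Progress in high-dimensional percolation and random graphs*,
  Springer 2017 — Prop. 5.5 (integrability of `Ĉⁿ` on the torus for `d > 2n`).
-/

open MeasureTheory Real Finset
open scoped BigOperators

namespace Literature.Probability.FitznerVanDerHofstad2017

open Literature.Barriers.CriticalPhenomena
open Literature.Barriers.CriticalPhenomena.Slade2006Prop53 (P)

variable {d : ℕ}

/-! ### Pointwise facts -/

/-- `D̂^{sin}(k) Ĉ(k) ≤ 2/d`. [cite: FitznerVanDerHofstad2016NoBLE, §5.2 (5.10) p. 1092] -/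
theorem Dsin_mul_Chat_le (hd : 1 ≤ d) (k : Fin d → ℝ) : Dsin d k * Chat d 1 k ≤ 2 / d := by
  have h := two_mul_Dsin_mul_Chat_le hd k
  rw [div_eq_mul_inv] at h ⊢
  linarith

/-- `M₂_{c,m} ≥ 0`. [folklore] -/
private theorem srwM2_nonneg (c m : ℕ) : 0 ≤ srwM2 d c m :=
  div_nonneg (integral_nonneg fun k => mul_nonneg
    (mul_nonneg (by rw [pow_mul]; exact pow_nonneg (sq_nonneg _) m) (sq_nonneg _))
    (pow_nonneg (Chat_one_nonneg k) c)) (two_pi_pow_pos d).le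

/-- Where `Ĉ (1 − D̂) = 1` (almost every `k`):
`M̂² Ĉ^c = D̂² Ĉ^c + 4 D̂^{sin} Ĉ^c − 4 D̂^{sin} Ĉ^{c+1} (1 − D̂^{sin} Ĉ)` (expand `M̂ = D̂ − 2 D̂^{sin} Ĉ` and use
`D̂ Ĉ = Ĉ − 1`). [cite: FitznerVanDerHofstad2016NoBLE, (3.26) p. 1070; §5.2 (5.1) p. 1090] -/
theorem Mhat_sq_mul_Chat_pow_eq (c : ℕ) (k : Fin d → ℝ) (hk : Chat d 1 k * (1 - Dhat d k) = 1) :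
    Mhat d k ^ 2 * Chat d 1 k ^ c =
      Dhat d k ^ 2 * Chat d 1 k ^ c + 4 * (Dsin d k * Chat d 1 k ^ c)
        - 4 * (Dsin d k * Chat d 1 k ^ (c + 1)) * (1 - Dsin d k * Chat d 1 k) := by
  have hDC : Dhat d k * Chat d 1 k = Chat d 1 k - 1 := by linear_combination (-1 : ℝ) * hk
  rw [Mhat]
  linear_combination (-4 * Dsin d k * Chat d 1 k ^ c) * hDC

/-- Where `Ĉ (1 − D̂) = 1`: `M̂² Ĉ^c ≤ D̂² Ĉ^c + 4 D̂^{sin} Ĉ^c − 4 (1 − 2/d) D̂^{sin} Ĉ^{c+1}`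
(`1 − D̂^{sin} Ĉ ≥ 1 − 2/d`, `D̂^{sin} Ĉ^{c+1} ≥ 0`). [cite: FitznerVanDerHofstad2016NoBLE, §5.2 (5.10) p. 1092] -/
theorem Mhat_sq_mul_Chat_pow_le (hd : 1 ≤ d) (c : ℕ) (k : Fin d → ℝ) (hk : Chat d 1 k * (1 - Dhat d k) = 1) :
    Mhat d k ^ 2 * Chat d 1 k ^ c ≤
      Dhat d k ^ 2 * Chat d 1 k ^ c + 4 * (Dsin d k * Chat d 1 k ^ c)
        - 4 * (1 - 2 / d) * (Dsin d k * Chat d 1 k ^ (c + 1)) := by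
  rw [Mhat_sq_mul_Chat_pow_eq c k hk]
  have h1 : Dsin d k * Chat d 1 k ≤ 2 / d := Dsin_mul_Chat_le hd k
  have h2 : 0 ≤ Dsin d k * Chat d 1 k ^ (c + 1) := mul_nonneg (Dsin_nonneg k) (pow_nonneg (Chat_one_nonneg k) _)
  nlinarith [mul_nonneg h2 (sub_nonneg.2 h1)]

/-- The `M₂`-integrand against the `I_{c,2m+2}(0)`-, `U_{c,2m}(0)`- and `U_{c+1,2m}(0)`-integrands, where
`Ĉ (1 − D̂) = 1`. [cite: FitznerVanDerHofstad2016NoBLE, (3.35)–(3.38) p. 1071; §5.2 (5.10) p. 1092] -/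
theorem srwM2_integrand_le (hd : 1 ≤ d) (c m : ℕ) (k : Fin d → ℝ) (hk : Chat d 1 k * (1 - Dhat d k) = 1) :
    (Dhat d k ^ (2 * m) * Mhat d k ^ 2) * Chat d 1 k ^ c ≤
      (Dhat d k ^ (2 * m + 2) * DhatSym d 0 k) * Chat d 1 k ^ c
        + 4 * ((|Dhat d k| ^ (2 * m) * |DhatSym d 0 k| * Dsin d k) * Chat d 1 k ^ c)
        - 4 * (1 - 2 / d) * ((|Dhat d k| ^ (2 * m) * |DhatSym d 0 k| * Dsin d k) * Chat d 1 k ^ (c + 1)) := by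
  have habs : |Dhat d k| ^ (2 * m) = Dhat d k ^ (2 * m) := by rw [pow_mul, pow_mul, sq_abs]
  have hD : 0 ≤ Dhat d k ^ (2 * m) := by rw [pow_mul]; exact pow_nonneg (sq_nonneg _) m
  have h := mul_le_mul_of_nonneg_left (Mhat_sq_mul_Chat_pow_le hd c k hk) hD
  rw [habs, DhatSym_zero, abs_one]
  calc (Dhat d k ^ (2 * m) * Mhat d k ^ 2) * Chat d 1 k ^ c
      = Dhat d k ^ (2 * m) * (Mhat d k ^ 2 * Chat d 1 k ^ c) := by ring
    _ ≤ Dhat d k ^ (2 * m) * (Dhat d k ^ 2 * Chat d 1 k ^ c + 4 * (Dsin d k * Chat d 1 k ^ c)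
          - 4 * (1 - 2 / d) * (Dsin d k * Chat d 1 k ^ (c + 1))) := h
    _ = _ := by ring

/-! ### `U_{c+1}` one power beyond the generic range, and Cauchy–Schwarz in the `Ĉ`-power -/

/-- The `U_{n+1,l}(x)`-integrand is integrable already for `d ≥ 2n + 1`: `D̂^{sin} Ĉ ≤ 2/d` is bounded, so the
weight `|D̂|^l |D̂^{(x)}| D̂^{sin} Ĉ` against `Ĉⁿ` is ([HvdH17] Prop. 5.5 via the tree's
`integrable_weight_mul_Chat_pow`). [cite: HeydenreichVanDerHofstad2017, Prop. 5.5] -/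
theorem integrable_srwU_integrand_succ {n : ℕ} (hd : 2 * n + 1 ≤ d) (l : ℕ) (x : Fin d → ℤ) :
    Integrable (fun k => (|Dhat d k| ^ l * |DhatSym d x k| * Dsin d k) * Chat d 1 k ^ (n + 1)) (P d) := by
  have hd1 : 1 ≤ d := by omega
  have hd0 : (1 : ℝ) ≤ d := by exact_mod_cast hd1
  have h := integrable_weight_mul_Chat_pow hd
    (w := fun k => (|Dhat d k| ^ l * |DhatSym d x k| * (Dsin d k * Chat d 1 k)) / 2)
    (((((continuous_Dhat d).measurable.abs.pow_const l).mul (measurable_DhatSym d x).abs).mul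
      ((continuous_Dsin d).measurable.mul (measurable_Chat_one d))).div_const 2)
    fun k => by
      have hDC : Dsin d k * Chat d 1 k ≤ 2 / d := Dsin_mul_Chat_le hd1 k
      have h2d : (2 : ℝ) / d ≤ 2 := by
        rw [div_le_iff₀ (by linarith)]
        linarith
      have hA : |Dhat d k| ^ l * |DhatSym d x k| ≤ 1 :=
        mul_le_one₀ (abs_Dhat_pow_le_one l k) (abs_nonneg _) (abs_DhatSym_le_one x k)
      have hA0 : 0 ≤ |Dhat d k| ^ l * |DhatSym d x k| := mul_nonneg (pow_nonneg (abs_nonneg _) l) (abs_nonneg _)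
      have hB : 0 ≤ Dsin d k * Chat d 1 k := mul_nonneg (Dsin_nonneg k) (Chat_one_nonneg k)
      rw [abs_div, abs_of_pos (by norm_num : (0 : ℝ) < 2), div_le_one (by norm_num), abs_mul,
        abs_of_nonneg hA0, abs_of_nonneg hB]
      nlinarith [mul_nonneg (sub_nonneg.2 hA) hB]
  refine (h.const_mul 2).congr (ae_of_all _ fun k => ?_)
  simp only
  ring

/-- Pointwise AM–GM behind `U_{n+1}² ≤ U_n U_{n+2}`: `w C^{n+1} ≤ (λ w Cⁿ + λ⁻¹ w C^{n+2})/2` for `w, C ≥ 0`, `λ > 0`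
(the difference is `w Cⁿ (λ − C)²/(2λ)`). [folklore] -/
private theorem mul_pow_succ_le_am_gm {w C : ℝ} (hw : 0 ≤ w) (hC : 0 ≤ C) (n : ℕ) {lam : ℝ} (hl : 0 < lam) :
    w * C ^ (n + 1) ≤ (lam * (w * C ^ n) + (w * C ^ (n + 2)) / lam) / 2 := by
  have key : (lam * (w * C ^ n) + (w * C ^ (n + 2)) / lam) / 2 - w * C ^ (n + 1) =
      w * C ^ n * (lam - C) ^ 2 / (2 * lam) := by
    field_simp
    ring
  have h0 : 0 ≤ w * C ^ n * (lam - C) ^ 2 / (2 * lam) := by positivity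
  linarith

/-- **Cauchy–Schwarz in the `Ĉ`-power: `U_{n+1,l}(x)² ≤ U_{n,l}(x) · U_{n+2,l}(x)`** (`d ≥ 2(n+1) + 1`; the
right factor converges by `integrable_srwU_integrand_succ`).  The (5.9) device ([HS92b] (B.25)–(B.27)) with the
split `Ĉ^{n+1} = Ĉ^{n/2} · Ĉ^{(n+2)/2}`. [cite: FitznerVanDerHofstad2016NoBLE, §5.2 (5.9) p. 1091] -/
theorem srwU_succ_sq_le {n : ℕ} (hd : 2 * (n + 1) + 1 ≤ d) (l : ℕ) (x : Fin d → ℤ) :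
    srwU d (n + 1) l x ^ 2 ≤ srwU d n l x * srwU d (n + 2) l x := by
  have hA := integrable_srwU_integrand (show 2 * n + 1 ≤ d by omega) l x
  have hB : Integrable (fun k => (|Dhat d k| ^ l * |DhatSym d x k| * Dsin d k) * Chat d 1 k ^ (n + 2)) (P d) :=
    integrable_srwU_integrand_succ hd l x
  have hle : srwU d (n + 1) l x ≤ Real.sqrt (srwU d n l x) * Real.sqrt (srwU d (n + 2) l x) := by
    refine le_sqrt_mul_sqrt_of_forall (srwU_nonneg n l x) (srwU_nonneg (n + 2) l x) fun lam hl => ?_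
    have key : ∫ k, (|Dhat d k| ^ l * |DhatSym d x k| * Dsin d k) * Chat d 1 k ^ (n + 1) ∂P d ≤
        ∫ k, (lam * ((|Dhat d k| ^ l * |DhatSym d x k| * Dsin d k) * Chat d 1 k ^ n) +
          ((|Dhat d k| ^ l * |DhatSym d x k| * Dsin d k) * Chat d 1 k ^ (n + 2)) / lam) / 2 ∂P d := by
      refine integral_mono_of_nonneg (ae_of_all _ fun k => ?_)
        (((hA.const_mul lam).add (hB.div_const lam)).div_const 2) (ae_of_all _ fun k => ?_)
      · exact mul_nonneg (mul_nonneg (mul_nonneg (pow_nonneg (abs_nonneg _) l) (abs_nonneg _)) (Dsin_nonneg k))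
          (pow_nonneg (Chat_one_nonneg k) _)
      · exact mul_pow_succ_le_am_gm
          (mul_nonneg (mul_nonneg (pow_nonneg (abs_nonneg _) l) (abs_nonneg _)) (Dsin_nonneg k))
          (Chat_one_nonneg k) n hl
    have e : ∫ k, (lam * ((|Dhat d k| ^ l * |DhatSym d x k| * Dsin d k) * Chat d 1 k ^ n) +
          ((|Dhat d k| ^ l * |DhatSym d x k| * Dsin d k) * Chat d 1 k ^ (n + 2)) / lam) / 2 ∂P d =
        (lam * (∫ k, (|Dhat d k| ^ l * |DhatSym d x k| * Dsin d k) * Chat d 1 k ^ n ∂P d) +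
          (∫ k, (|Dhat d k| ^ l * |DhatSym d x k| * Dsin d k) * Chat d 1 k ^ (n + 2) ∂P d) / lam) / 2 := by
      rw [integral_div, integral_add (hA.const_mul lam) (hB.div_const lam), integral_const_mul, integral_div]
    unfold srwU
    calc (∫ k, (|Dhat d k| ^ l * |DhatSym d x k| * Dsin d k) * Chat d 1 k ^ (n + 1) ∂P d) / (2 * π) ^ d
        ≤ ((lam * (∫ k, (|Dhat d k| ^ l * |DhatSym d x k| * Dsin d k) * Chat d 1 k ^ n ∂P d) +
            (∫ k, (|Dhat d k| ^ l * |DhatSym d x k| * Dsin d k) * Chat d 1 k ^ (n + 2) ∂P d) / lam) / 2) /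
            (2 * π) ^ d :=
          div_le_div_of_nonneg_right (key.trans_eq e) (two_pi_pow_pos d).le
      _ = _ := by ring
  calc srwU d (n + 1) l x ^ 2 ≤ (Real.sqrt (srwU d n l x) * Real.sqrt (srwU d (n + 2) l x)) ^ 2 :=
        pow_le_pow_left₀ (srwU_nonneg (n + 1) l x) hle 2
    _ = srwU d n l x * srwU d (n + 2) l x := by
        rw [mul_pow, Real.sq_sqrt (srwU_nonneg n l x), Real.sq_sqrt (srwU_nonneg (n + 2) l x)]

/-! ### `M₂` through `I` and `U` -/

/-- **`M₂_{c,m} ≤ I_{c,2m+2}(0) + 4 U_{c,2m}(0) − 4 (1 − 2/d) U_{c+1,2m}(0)`** for `d ≥ 2c + 1` (every integral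
convergent; `U_{c+1,2m}(0)` by `integrable_srwU_integrand_succ`).
[cite: FitznerVanDerHofstad2016NoBLE, (3.26), (3.35)–(3.38) p. 1070–1071; §5.2 (5.10) p. 1092] -/
theorem srwM2_le_I_U {c : ℕ} (hc : 2 * c + 1 ≤ d) (m : ℕ) :
    srwM2 d c m ≤ srwI d c (2 * m + 2) 0 + 4 * srwU d c (2 * m) 0 - 4 * (1 - 2 / d) * srwU d (c + 1) (2 * m) 0 := by
  have hd1 : 1 ≤ d := by omega
  have hM := integrable_srwM2_integrand hc m (d := d)
  have hI := integrable_srwI_integrand hc (2 * m + 2) (0 : Fin d → ℤ)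
  have hU := integrable_srwU_integrand hc (2 * m) (0 : Fin d → ℤ)
  have hU' := integrable_srwU_integrand_succ hc (2 * m) (0 : Fin d → ℤ)
  have hIU : Integrable (fun k => (Dhat d k ^ (2 * m + 2) * DhatSym d 0 k) * Chat d 1 k ^ c
      + 4 * ((|Dhat d k| ^ (2 * m) * |DhatSym d 0 k| * Dsin d k) * Chat d 1 k ^ c)) (P d) :=
    hI.add (hU.const_mul 4)
  have hR : Integrable (fun k => (Dhat d k ^ (2 * m + 2) * DhatSym d 0 k) * Chat d 1 k ^ c
      + 4 * ((|Dhat d k| ^ (2 * m) * |DhatSym d 0 k| * Dsin d k) * Chat d 1 k ^ c)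
      - 4 * (1 - 2 / d) * ((|Dhat d k| ^ (2 * m) * |DhatSym d 0 k| * Dsin d k) * Chat d 1 k ^ (c + 1))) (P d) :=
    hIU.sub (hU'.const_mul _)
  have key : ∫ k, (Dhat d k ^ (2 * m) * Mhat d k ^ 2) * Chat d 1 k ^ c ∂P d ≤
      ∫ k, ((Dhat d k ^ (2 * m + 2) * DhatSym d 0 k) * Chat d 1 k ^ c
        + 4 * ((|Dhat d k| ^ (2 * m) * |DhatSym d 0 k| * Dsin d k) * Chat d 1 k ^ c)
        - 4 * (1 - 2 / d) * ((|Dhat d k| ^ (2 * m) * |DhatSym d 0 k| * Dsin d k) * Chat d 1 k ^ (c + 1))) ∂P d := by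
    refine integral_mono_ae hM hR ?_
    filter_upwards [ae_Chat_mul_one_sub_Dhat (d := d) hd1] with k hk
    exact srwM2_integrand_le hd1 c m k hk
  have e : ∫ k, ((Dhat d k ^ (2 * m + 2) * DhatSym d 0 k) * Chat d 1 k ^ c
        + 4 * ((|Dhat d k| ^ (2 * m) * |DhatSym d 0 k| * Dsin d k) * Chat d 1 k ^ c)
        - 4 * (1 - 2 / d) * ((|Dhat d k| ^ (2 * m) * |DhatSym d 0 k| * Dsin d k) * Chat d 1 k ^ (c + 1))) ∂P d =
      (∫ k, (Dhat d k ^ (2 * m + 2) * DhatSym d 0 k) * Chat d 1 k ^ c ∂P d)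
        + 4 * (∫ k, (|Dhat d k| ^ (2 * m) * |DhatSym d 0 k| * Dsin d k) * Chat d 1 k ^ c ∂P d)
        - 4 * (1 - 2 / d) * ∫ k, (|Dhat d k| ^ (2 * m) * |DhatSym d 0 k| * Dsin d k) * Chat d 1 k ^ (c + 1) ∂P d := by
    rw [integral_sub hIU (hU'.const_mul _), integral_add hI (hU.const_mul 4), integral_const_mul,
      integral_const_mul]
  unfold srwM2 srwI srwU
  calc (∫ k, (Dhat d k ^ (2 * m) * Mhat d k ^ 2) * Chat d 1 k ^ c ∂P d) / (2 * π) ^ d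
      ≤ ((∫ k, (Dhat d k ^ (2 * m + 2) * DhatSym d 0 k) * Chat d 1 k ^ c ∂P d)
          + 4 * (∫ k, (|Dhat d k| ^ (2 * m) * |DhatSym d 0 k| * Dsin d k) * Chat d 1 k ^ c ∂P d)
          - 4 * (1 - 2 / d) * ∫ k, (|Dhat d k| ^ (2 * m) * |DhatSym d 0 k| * Dsin d k) * Chat d 1 k ^ (c + 1) ∂P d) /
          (2 * π) ^ d :=
        div_le_div_of_nonneg_right (key.trans_eq e) (two_pi_pow_pos d).le
    _ = _ := by ring

/-! ### The pairing with a general split of the `Ĉ`-power -/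

/-- Pointwise AM–GM with a general split: for `c₁ + c₂ = 2n` and `λ > 0`,
`|D̂|^{m+j} |D̂^{(x)}| |M̂| Ĉⁿ ≤ (λ · D̂^{2m} M̂² Ĉ^{c₁} + λ⁻¹ · D̂^{2j} (D̂^{(x)})² Ĉ^{c₂}) / 2`
(`Ĉⁿ = (Ĉ^{c₁})^{1/2} (Ĉ^{c₂})^{1/2}` since `Ĉ ≥ 0`). [cite: FitznerVanDerHofstad2016NoBLE, §5.2 (5.9) p. 1091] -/
theorem srwT_integrand_le_pairing' {c₁ c₂ n : ℕ} (h : c₁ + c₂ = 2 * n) (m j : ℕ) (x : Fin d → ℤ)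
    (k : Fin d → ℝ) {lam : ℝ} (hl : 0 < lam) :
    (|Dhat d k| ^ (m + j) * |DhatSym d x k| * |Mhat d k|) * Chat d 1 k ^ n ≤
      (lam * ((Dhat d k ^ (2 * m) * Mhat d k ^ 2) * Chat d 1 k ^ c₁) +
        lam⁻¹ * ((Dhat d k ^ (2 * j) * DhatSym d x k ^ 2) * Chat d 1 k ^ c₂)) / 2 := by
  have hC := Chat_one_nonneg k
  have hs2 : Real.sqrt (Chat d 1 k ^ c₁) ^ 2 = Chat d 1 k ^ c₁ := Real.sq_sqrt (pow_nonneg hC _)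
  have ht2 : Real.sqrt (Chat d 1 k ^ c₂) ^ 2 = Chat d 1 k ^ c₂ := Real.sq_sqrt (pow_nonneg hC _)
  have hst : Real.sqrt (Chat d 1 k ^ c₁) * Real.sqrt (Chat d 1 k ^ c₂) = Chat d 1 k ^ n := by
    rw [← Real.sqrt_mul (pow_nonneg hC _), ← pow_add, h, pow_mul', Real.sqrt_sq (pow_nonneg hC _)]
  have h0 := abs_mul_abs_le_am_gm (Dhat d k ^ m * Mhat d k * Real.sqrt (Chat d 1 k ^ c₁))
    (Dhat d k ^ j * DhatSym d x k * Real.sqrt (Chat d 1 k ^ c₂)) hl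
  have e1 : |Dhat d k ^ m * Mhat d k * Real.sqrt (Chat d 1 k ^ c₁)| *
      |Dhat d k ^ j * DhatSym d x k * Real.sqrt (Chat d 1 k ^ c₂)| =
      (|Dhat d k| ^ (m + j) * |DhatSym d x k| * |Mhat d k|) * Chat d 1 k ^ n := by
    rw [← hst]
    simp only [abs_mul, abs_pow, abs_of_nonneg (Real.sqrt_nonneg (Chat d 1 k ^ c₁)),
      abs_of_nonneg (Real.sqrt_nonneg (Chat d 1 k ^ c₂))]
    ring
  have e2 : (Dhat d k ^ m * Mhat d k * Real.sqrt (Chat d 1 k ^ c₁)) ^ 2 =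
      (Dhat d k ^ (2 * m) * Mhat d k ^ 2) * Chat d 1 k ^ c₁ := by
    rw [mul_pow, hs2]
    ring
  have e3 : (Dhat d k ^ j * DhatSym d x k * Real.sqrt (Chat d 1 k ^ c₂)) ^ 2 =
      (Dhat d k ^ (2 * j) * DhatSym d x k ^ 2) * Chat d 1 k ^ c₂ := by
    rw [mul_pow, ht2]
    ring
  rw [e1, e2, e3] at h0
  refine h0.trans (le_of_eq ?_)
  ring

/-- **Pairing with a general split: `T_{n,m+j}(x) ≤ [M₂_{c₁,m}]^{1/2} [W_{c₂,j}(x)]^{1/2}`** whenever `c₁ + c₂ = 2n`,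
`d ≥ 2c₁ + 1`, `d ≥ 2c₂ + 1` (the even case `c₁ = 2α`, `c₂ = 2β` is `srwT_le_sqrt_srwM2_mul_srwW`).
[cite: FitznerVanDerHofstad2016NoBLE, §5.2 (5.9) p. 1091] -/
theorem srwT_le_sqrt_srwM2_mul_srwW' {c₁ c₂ n : ℕ} (h : c₁ + c₂ = 2 * n) (h₁ : 2 * c₁ + 1 ≤ d)
    (h₂ : 2 * c₂ + 1 ≤ d) (m j : ℕ) (x : Fin d → ℤ) :
    srwT d n (m + j) x ≤ Real.sqrt (srwM2 d c₁ m) * Real.sqrt (srwW d c₂ j x) := by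
  refine le_sqrt_mul_sqrt_of_forall (srwM2_nonneg c₁ m) (srwW_nonneg c₂ j x) fun lam hl => ?_
  have hA := integrable_srwM2_integrand h₁ m (d := d)
  have hB := integrable_srwW_integrand h₂ j x
  have key : ∫ k, (|Dhat d k| ^ (m + j) * |DhatSym d x k| * |Mhat d k|) * Chat d 1 k ^ n ∂P d ≤
      ∫ k, (lam * ((Dhat d k ^ (2 * m) * Mhat d k ^ 2) * Chat d 1 k ^ c₁) +
        lam⁻¹ * ((Dhat d k ^ (2 * j) * DhatSym d x k ^ 2) * Chat d 1 k ^ c₂)) / 2 ∂P d := by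
    refine integral_mono_of_nonneg (ae_of_all _ fun k => ?_)
      (((hA.const_mul lam).add (hB.const_mul lam⁻¹)).div_const 2)
      (ae_of_all _ fun k => srwT_integrand_le_pairing' h m j x k hl)
    exact mul_nonneg (mul_nonneg (mul_nonneg (pow_nonneg (abs_nonneg _) _) (abs_nonneg _)) (abs_nonneg _))
      (pow_nonneg (Chat_one_nonneg k) _)
  have e : ∫ k, (lam * ((Dhat d k ^ (2 * m) * Mhat d k ^ 2) * Chat d 1 k ^ c₁) +
        lam⁻¹ * ((Dhat d k ^ (2 * j) * DhatSym d x k ^ 2) * Chat d 1 k ^ c₂)) / 2 ∂P d =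
      (lam * (∫ k, (Dhat d k ^ (2 * m) * Mhat d k ^ 2) * Chat d 1 k ^ c₁ ∂P d) +
        lam⁻¹ * ∫ k, (Dhat d k ^ (2 * j) * DhatSym d x k ^ 2) * Chat d 1 k ^ c₂ ∂P d) / 2 := by
    rw [integral_div, integral_add (hA.const_mul lam) (hB.const_mul lam⁻¹), integral_const_mul,
      integral_const_mul]
  unfold srwT srwM2 srwW
  calc (∫ k, (|Dhat d k| ^ (m + j) * |DhatSym d x k| * |Mhat d k|) * Chat d 1 k ^ n ∂P d) / (2 * π) ^ d
      ≤ ((lam * (∫ k, (Dhat d k ^ (2 * m) * Mhat d k ^ 2) * Chat d 1 k ^ c₁ ∂P d) +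
          lam⁻¹ * ∫ k, (Dhat d k ^ (2 * j) * DhatSym d x k ^ 2) * Chat d 1 k ^ c₂ ∂P d) / 2) / (2 * π) ^ d :=
        div_le_div_of_nonneg_right (key.trans_eq e) (two_pi_pow_pos d).le
    _ = _ := by ring

/-- **Table-ready form of the pairing**: if `M₂_{c₁,m} ≤ A`, `W_{c₂,j}(x) ≤ B`, `0 ≤ t` and `A · B ≤ t²`, then
`T_{n,m+j}(x) ≤ t` (`c₁ + c₂ = 2n`, `d ≥ 2c₁+1`, `d ≥ 2c₂+1`). [cite: FitznerVanDerHofstad2016NoBLE, §5.2 (5.9) p. 1091] -/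
theorem srwT_le_of_srwM2_le_of_srwW_le {c₁ c₂ n : ℕ} (h : c₁ + c₂ = 2 * n) (h₁ : 2 * c₁ + 1 ≤ d)
    (h₂ : 2 * c₂ + 1 ≤ d) (m j : ℕ) (x : Fin d → ℤ) {A B t : ℝ} (hA : srwM2 d c₁ m ≤ A)
    (hB : srwW d c₂ j x ≤ B) (ht : 0 ≤ t) (hAB : A * B ≤ t ^ 2) :
    srwT d n (m + j) x ≤ t := by
  have hM0 := srwM2_nonneg c₁ m (d := d)
  have hA0 : 0 ≤ A := hM0.trans hA
  calc srwT d n (m + j) x ≤ Real.sqrt (srwM2 d c₁ m) * Real.sqrt (srwW d c₂ j x) :=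
        srwT_le_sqrt_srwM2_mul_srwW' h h₁ h₂ m j x
    _ ≤ Real.sqrt A * Real.sqrt B :=
        mul_le_mul (Real.sqrt_le_sqrt hA) (Real.sqrt_le_sqrt hB) (Real.sqrt_nonneg _) (Real.sqrt_nonneg _)
    _ = Real.sqrt (A * B) := (Real.sqrt_mul hA0 B).symm
    _ ≤ Real.sqrt (t ^ 2) := Real.sqrt_le_sqrt hAB
    _ = t := Real.sqrt_sq ht

end Literature.Probability.FitznerVanDerHofstad2017
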